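import Summits.QuantumFields.YangMills.Theorems.BalabanUVNodesN11K1CeilingFreeOfSupplyChain
import Literature.MathematicalPhysics.QuantumFieldTheory.Balaban1983to89.Node00.Record13SepCoPHChi
import Literature.MathematicalPhysics.QuantumFieldTheory.Balaban1983to89.Node00.Record13ResidualsRChi
import Summits.QuantumFields.YangMills.Theorems.BalabanUVNodesN11HistoryPinnedResidualDefsChi
import Summits.QuantumFields.YangMills.Theorems.BalabanUVNodesN11RePinnedParamDefsChi
import Summits.QuantumFields.YangMills.Theorems.BalabanUVNodesN11NoExpansionAtRecord13CoPChi
import Summits.QuantumFields.YangMills.Theorems.BalabanUVNodesN11NoExpansionDiagonalCoPHChi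
import Summits.QuantumFields.YangMills.Theorems.BalabanUVNodesN11BackgroundScaleLocalChi
import Summits.QuantumFields.YangMills.Theorems.BalabanUVNodesN11Sect3SupplyPresentParentsChi
import Summits.QuantumFields.YangMills.Theorems.BalabanUVNodesN11NoExpansionOldFactorsChi
import Summits.QuantumFields.YangMills.Theorems.BalabanUVNodesN11NoExpansionGeneralStepCoPHOldBranchChi
import Summits.QuantumFields.YangMills.Theorems.BalabanUVNodesN11NoExpansionGeneralStepLawsCoPHChi
import Summits.QuantumFields.YangMills.Theorems.BalabanUVNodesN11NoExpansionGeneralStepGraphChi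
import Summits.QuantumFields.YangMills.Theorems.BalabanUVNodesN11DiagonalOldBranchMeasurableChi
import Summits.QuantumFields.YangMills.Theorems.BalabanUVNodesN11OldBranchPairChi
import Summits.QuantumFields.YangMills.Theorems.BalabanUVNodesN11TruncationDominationChi
import Summits.QuantumFields.YangMills.Theorems.BalabanUVNodesN11Sect3SupplySplicePairChi
import Summits.QuantumFields.YangMills.Theorems.BalabanUVNodesN11Sect3SupplyChainDefsChi
import Summits.QuantumFields.YangMills.Theorems.BalabanUVNodesN11Sect3SupplyChainChi
import Summits.QuantumFields.YangMills.Theorems.BalabanUVNodesN11GaussianCertificateRowsChi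
import Summits.QuantumFields.YangMills.Theorems.BalabanUVNodesN11GaussianCertificateDefsChi
import Summits.QuantumFields.YangMills.Theorems.BalabanUVNodesN11Sect3SupplyChainObligationsPairChi
import Literature.MathematicalPhysics.QuantumFieldTheory.Balaban1983to89.B16RLeafRecord13LiveCoPHChi

/-!
# χ-GENERIC RE-ISSUE (WORK ORDER RC-1 «RE-CENTRE THE RECORD», director-ym №462 (B) ∕ №467 (D)) of `BalabanUVNodesN11K1CeilingFreeOfSupplyChain`

Cell `pub-ymgap` (HUMAN RULING D-0062, Track A), seat `pub-ymgap-dag-n11-d` (N11 [B14] s2; N11-σ campaign, `N11-G44-RC1-REACH-CENSUS.md`).  The CENTRE-TYPED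
declarations of `BalabanUVNodesN11K1CeilingFreeOfSupplyChain` (those whose statement reads the (2.9) cut-off centre through `gOfRecord₁₃ ∕ EOfRecord₁₃ ∕ Provisos₁₃… ∕ T∕SLaw₁₃… ∕
UbgOfRecord₁₃… ∕ WtOfRecord₁₃… ∕ datum∕tower∕coreOfRecord₁₃…`) RE-ISSUED VERBATIM in the β-slot `χ : ChiSlot F N` over [Ax-3b]∕[Ax-3c]∕[Ax-3d]'s χ-generic carriers
(`Node00/Record13Chi` ∕ `Record13CoPHChi` ∕ `Record13SepCoPHChi`): σ = (binder `(χ : ChiSlot F N)` after `θ`; Node00 defs `X ↦ XChi … χ`; Node00 rows `Y ↦ Y_chi`;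
this lane's sibling modules `…Chi` for Summits-side dependencies); SAME short names in the sibling namespace `…BalabanUVNodesN11K1CeilingFreeOfSupplyChainChi` (consumers switch by namespace);
the 6 centre-FREE declarations of the original are NOT copied — they are reused BY NAME (`open … (…)` below).  At `χ := chiβOfRecord₁₃ θ` every statement here is
EQUIVALENT to the landed one through [Ax-3b∕3c∕3d]'s receipts (defs: `rfl`; re-declared Prop-structures such as `Provisos₁₃…Chi` ∕ `IsNoExpHistAt`: field-wise `Iff`, hence objects built over them — `ZhPinOfRecord₁₃`, `rePinH`, `gaussPinH` — propositionally, not definitionally, equal; no such receipt is landed or needed: the consumer reads the Ax slot); at `χ := chiβOfRecord₁₃Ax θ` it is what the Ax-record's N11 machine reads.  Nothing of record edited (body-freeze №460 (2)).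

HONEST FRAMING.  Count-neutral kernel re-elaboration of landed N11 bookkeeping∕estimates in a parameter; every HYPOTHESIS of the original stays a hypothesis; nothing of
Bałaban asserted beyond what the original file proves; N11 NOT discharged; K-items untouched; counts unmoved.  One finite `𝕋⁴_{L^K}` programme at fixed `ε = L^{−K}` —
NOT ℝ⁴, NOT OS, NOT a mass gap, NOT Clay.  No `sorry`∕`instance`∕`notation`.  Sources: as the original module, plus [I] = [Balaban1987RG1] (2.9) p.266 (the cut-off's centre).
-/

noncomputable section

open scoped Matrix.Norms.L2Operator

namespace Summit.QuantumFields.YangMills.Theorems.BalabanUVNodesN11K1CeilingFreeOfSupplyChainChi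

open Summit.QuantumFields.YangMills.Theorems.BalabanUVNodesN11K1CeilingFreeOfSupplyChain (nodes_leavesP_withCeiling_of_b14_main nodes_leavesP_withCeiling_of_supplyChainAt rung1At_withCeiling_of_supplyChainAt stabilityB_body_of_rung1At_of_runLetters_of_supplyChainAt stabilityB_body_of_rung1At_of_runRemAt_of_drift_of_supplyChainAt stabilityBAtRecordR13SepCoPH_of_rung1WithChain_of_runRemAt)
open Literature.MathematicalPhysics.QuantumFieldTheory.Balaban1983to89
open Literature.MathematicalPhysics.QuantumFieldTheory.Balaban1983to89.Node00
open DagBinding T4Continuum T4DatumAssembly FlowStepRuns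
open FlowStep (RGEqH prefixOf)
open Literature.MathematicalPhysics.QuantumFieldTheory.Balaban1983to89.Beta.Drift (OneLoopDrift)
open Literature.MathematicalPhysics.QuantumFieldTheory.Balaban1983to89.B16RLeafRecord13LiveCoPHChi (b14_main_at_record₁₃CoPH_of_rOpLeaf rOpLeaf_VOfRecord₁₃CoPH_of_liveSel_of_rstep)
open Summit.QuantumFields.YangMills.Theorems.BalabanUVNodesK2JsOfRecord (StepColourData beta0OfJs)
open Summit.QuantumFields.YangMills.Theorems.BalabanUVNodesK2NamedJetsRunRemAt (RunRemAt RunConstRemainder)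
open Summit.QuantumFields.YangMills.BalabanUVNodes.K1EndOfNodes13PWSOfRunRemAt (stabilityB_body_of_rung1At_of_runLetters stabilityB_body_of_rung1At_of_runRemAt_of_drift)
open Summit.QuantumFields.YangMills.Theorems.StabilityBAtRecordR13SepCoPH.Negative.SignBoxAtEveryWitnessFalse (withCeiling Rung1At)
open BalabanUVNodesN11Sect3SupplyChainObligationsDefsChi (SupplyChainAt thmP245Laws_of_supplyChainAt)
open BalabanUVNodesN11Sect3SupplyChainNode (b14_main_of_obligations)

variable {F : T4Family} {N : ℕ} [NeZero N]

/-! ## §1  The UPWARD ceiling re-lettering of the thirteen nodes costs exactly N11 — and N11 on the chain road does not read the ceiling -/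

section Nodes

variable {θ χ : Stage13HParams F N} {χ : ChiSlot F N} {p : B12.RunParams}

/-- **★ N11's NODE AT ANY WORLD BOUND TO THE CoPH DATUM OF `θ`, THE CHAIN ASKED ONLY ON RUNS INSIDE THE WORLD's OWN WINDOW** (`βup`, `β₀`, `b`, `L`, `up` UNREAD): dag-n11-e's
`b14_main_of_obligations` threaded through the node's own `smallCouplings` antecedent — if the run `p` lies in the window `]0, w.γ]` of the world, N11's one-token residual
`SupplyChainAt θ χ p` on the live-selector line gives the (S1ᵀ) slot (`thmP245Laws_of_supplyChainAt`); the 𝐑-antecedent is read through the leaf (`rOpLeaf_VOfRecord₁₃CoPH_of_liveSel_of_rstep`).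
[cite: Balaban1988Convergent, Thm 1 p.262, Theorem p.245, p.244 L36–38, (2.6) p.255; Balaban1989LargeFieldI, (0.3) p.176, p.177 (i)–(ii)] -/
theorem b14_main_leavesP_of_supplyChainAt_of_window (h : θ.Provisos₁₃CoPHChi F N χ)
    (hsel : θ.ppSel = ppSelLiveOfRecord F N θ.ν θ.τ9 (EOfRecord₁₃Chi F N θ.toStage13Params χ) (wOfRecord₉ F N θ.toStage9Params))
    (hθ : θ.Admissible F N) (hκ : 0 ≤ θ.s2.lf.κ) (hE₀ : 0 ≤ θ.s2.lf.E₀) (hB₀ : 0 ≤ θ.s2.lf.B₀) (hM : 1 ≤ θ.τ9.M)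
    (w : WorldP) (hC : w.C = (datumOfRecord₁₃CoPHChi F N θ χ h).C)
    (hN : ((datumOfRecord₁₃CoPHChi F N θ χ h).C p).flow.InInterval w.γ p.K → SupplyChainAt θ χ p) :
    Dag.B14_main (leavesP w p) :=
  b14_main_at_record₁₃CoPH_of_rOpLeaf F N θ χ p w h hC
    (fun _ => rOpLeaf_VOfRecord₁₃CoPH_of_liveSel_of_rstep F N θ χ p (fun q j _ hj => h.rstep q j hj) hθ hκ hE₀ hB₀ hsel)
    (fun _ _ _ _ _ hsc _ _ => thmP245Laws_of_supplyChainAt h hsel hθ hκ hE₀ hB₀ hM (hN (by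
      have hsc' : (w.C p).flow.InInterval w.γ p.K := hsc
      rwa [hC] at hsc')))

end Nodes

/-! ## §2  p602267's rung-1 datum passes to every ceiling (the UPWARD twin of `rung1At_lowerβup`) -/

/-! ## §3  dag-n24-w1's two run-letter closing faces of p598782 WITHOUT the match hypothesis -/

/-! ## §4  The route decl BY NAME from ONE ∃-side producer «rung 1 WITH N11's chain at the witness + K2⁷'s run letter + the bare drift» — no ceiling letter anywhere -/

end Summit.QuantumFields.YangMills.Theorems.BalabanUVNodesN11K1CeilingFreeOfSupplyChainChi

end

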